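import Literature.Computability.Complexity.RossmanMonotoneCliqueFinite
import HarnessLib

/-!
# Rossman 2010, Theorem 1 with sparse noise: the finite dichotomy (class parameter decoupled)

A variant of the proof (§6, pp. 8–9) of Theorem 1 of

* B. Rossman, *The monotone complexity of k-clique on random graphs*, FOCS 2010, pp. 193–201
  (full version 2009; SIAM J. Comput. 43 (2014) 256–279) [Rossman2010],

carried out at ONE number of vertices `n`, with TWO changes with respect to the in-tree finite
form `thm1_finite` (`RossmanMonotoneCliqueFinite.lean`).

1. **The class parameter is decoupled from the clique size.** The ⋆-closed approximation `C̄` of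
   a `{∧₂, ∨₂}`-circuit (`exists_closedApprox`, §5.2) is taken with respect to the classes
   `I = smallI n k'` (graphs with `< k'/2` non-isolated vertices) and `J = medJ n k'` for a second
   parameter `5 ≤ k' ≤ k`, `k` being the size of the planted clique `K_A` (think of `k' = 4(c+1)`
   fixed while `k` is large). Lemmas 9, 13, 14 and the count of Lemma 16 are insensitive to this:
   the only place where `k` enters is the fibre bound `Pr_A[supp H ⊆ A] ≤ (k/n)^{supp H}`.
2. **Lemma 15 (Janson / spread lemma: a dense family of accepted `K_A - e` forces acceptance of
   the noise) is REPLACED by a plain count of the NON-EMPTY SMALL minterms at the output.** If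
   `C̄(∅) = 0`, every accepted clique `K_A` lies above a non-empty minterm `H` of `C̄`; either
   `H ∈ I` — and Lemma 9 counts the minterms of the closed function `C̄` in `I` of each signature
   `(supp H, |E_H|) = (v, s)`, `s ≥ 1`, by `(B log(s/t)/p)^s` — or, by Lemma 14 (minterm
   locality), some gate of `C̄` has a minterm `H' ∈ J` below `K_A`, counted by Lemma 16 with
   Lemma 9 exactly as in the paper. If `C̄(∅) = 1` then `C̄ ≡ 1` and Lemma 13 alone gives
   `Pr[C(G(n,p)) = 1] ≥ 1 - size(C)·|I ∪ J|·t`. NO density requirement on the noise `G(n,p)`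
   (no supercriticality for cliques minus an edge, no spreadness) is needed any more: the finite
   statement is a clean dichotomy, valid for all `0 < p ≤ 1/2`, `0 < t ≤ 1/2`, `t < 1 - p`, and
   all asymptotics are left to corollaries.

Contents:

* `sigWeight_nonneg` — the signature weights `(B log(s/t)/p)^s (k/n)^v` are `≥ 0` for `s ≥ 1`;
* `card_covered_cliques_le_of_subset` — **Lemma 16 with Lemma 9, for an arbitrary pattern class**
  `P ⊆ K` of non-empty graphs inside a class `K` closed under subgraphs: if every `k`-set of a
  family `M` is covered by a minterm `H ∈ P`, `H ⊆ K_A`, of one of `L` monotone functions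
  ⋆-closed w.r.t. `K`, then `|M| ≤ L · C(n,k) · Σ_{(v,s) ∈ sig(P)} (B log(s/t)/p)^s (k/n)^v`;
* `card_covered_cliques_le₂` — the case `K = I ∪ J`, `P = J` at class parameter `k'`
  (the two-parameter form of `card_covered_cliques_le`);
* `card_smallCovered_cliques_le` — the case `L = 1`, `P = {H ∈ I : E_H ≠ ∅}` (the I-count
  replacing Lemma 15);
* `thm1_sparse_finite` — **the sparse-noise Theorem 1, finite form**: for `5 ≤ k' ≤ k ≤ n`,
  `0 < p ≤ 1/2`, `0 < t ≤ 1/2`, `t < 1 - p` and a circuit `C` over `{∧₂, ∨₂, 0, 1}` on the edges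
  of `Kₙ`, EITHER
  `Pr_A[C(K_A) = 1] ≤ Σ_{(v,s) ∈ sig(I), s ≥ 1} W(v,s) + size(C) · Σ_{(v,s) ∈ sig(J)} W(v,s)`,
  `W(v,s) = (B log(s/t)/p)^s (k/n)^v`, OR `Pr[C(G(n,p)) = 1] ≥ 1 - size(C) · |I ∪ J| · t`
  (the probability written as `gnpProb n p {x | C x = 1}`, as in `thm1_finite`; it equals
  `prob p (C · = 1)` by `gnpProb_filter_eq_prob`).

Informal significance (not formalised here). Fix `c`, `k' = 4(c+1) ≤ k` (constants) and take the
noise `p = n^{-σ'}` with threshold `t = exp(-n^{σ'/2})`. For large `n` the weights satisfy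
`W(v,s) ≤ (2B)^s n^{3σ's/2} (k/n)^v`. Over the non-empty patterns of `I` (`2 ≤ v < k'/2`,
`1 ≤ s ≤ C(v,2)`) the exponent `3σ's/2 - v` is `≤ -v/2 ≤ -1` once `σ' ≤ 4/(3k')`; over `J` the
signature inequality `medJ_ineq` (`v - 2s/(k'-1) ≥ (k'² + 7)/(4(k'-1)) > k'/4 + 1/4`) gives
`c + 3σ's/2 - v < -5/4` under the same condition. So for circuits of size `≤ n^c` the first
alternative reads `Pr_A[C(K_A) = 1] ≤ o(1)`, while in the second
`size(C) · |I ∪ J| · t ≤ n^{c + k'} 2^{C(k',2)} e^{-n^{σ'/2}} = o(1)`: a monotone circuit of size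
`n^c` accepting a constant fraction of the planted `k`-cliques accepts `G(n, n^{-σ'})` with
probability `1 - o(1)` for every `σ' ≤ 4/(3k') = 1/(3(c+1))` — a sprinkle exponent INDEPENDENT
of the clique size `k`, whereas Theorem 1 itself needs the dense noise
`p⁻ = n^{-2(1+δ)/(k-1)}`. This is the first `k`-uniform point ("sparse-noise Theorem 1") of the
sparse-dose dial studied under route PneNP/OneSlice (crux `SingleThreshold`); the price is that
the conclusion is about ISOLATED planted cliques versus pure sparse noise, with no background.

Provenance. The dichotomy and the counts are Rossman's §6 (Lemmas 9, 13, 14, 16) verbatim up to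
the two changes above; the I-count `card_smallCovered_cliques_le` replacing Lemma 15 is NOT in the
source (it is the same Lemma 9/Lemma 16 computation run over `I` instead of `J`), so the theorem
is tagged as a variant of Theorem 1.

Not here: the asymptotic corollary (choice of `σ'`, `t`, summation of the weights), any statement
relative to a background graph, and the original Case 1 (Lemma 15), which remains available as
`one_sub_lt_prob_of_dense`.

## References

* [Rossman2010] B. Rossman, The monotone complexity of k-clique on random graphs, FOCS 2010,
  193–201; SIAM J. Comput. 43 (2014) 256–279 — Theorem 1 (p. 4), Lemma 9 (p. 7), Lemmas 13–14
  (p. 8), Lemmas 15–16 and the final count (p. 9).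
-/

noncomputable section

namespace Literature.Computability.Complexity

open Finset GateList Literature.Combinatorics.SetFamily
open scoped Classical

/-! ### Signature weights -/

/-- The signature weight `(B log(s/t)/p)^s (k/n)^v` is nonnegative as soon as `s ≥ 1`, `0 ≤ p`
and `0 < t ≤ 1` (then `log(s/t) ≥ 0`). [folklore] -/
theorem sigWeight_nonneg {n k : ℕ} {p t : ℝ} (hp0 : 0 ≤ p) (ht0 : 0 < t) (ht1 : t ≤ 1)
    {σ : ℕ × ℕ} (hs : 1 ≤ σ.2) : 0 ≤ sigWeight n k p t σ := by
  have hs' : (1 : ℝ) ≤ σ.2 := by exact_mod_cast hs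
  have hlog : 0 ≤ Real.log (σ.2 / t) := Real.log_nonneg (by rw [le_div_iff₀ ht0]; linarith)
  unfold sigWeight
  exact mul_nonneg (pow_nonneg (div_nonneg (mul_nonneg spreadConst_pos.le hlog) hp0) _)
    (pow_nonneg (div_nonneg (Nat.cast_nonneg _) (Nat.cast_nonneg _)) _)

/-! ### Lemma 16 with Lemma 9 for an arbitrary pattern class -/

/-- **Lemma 16 combined with Lemma 9, for an arbitrary pattern class** (Rossman 2010, p. 9, the
computation `Pr[K_A ∈ M(C̄)] ≤ Σᵢ |M_{Fᵢ}| · O(n^{-supp Fᵢ})` with Lemma 9 bounding each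
`|M_{Fᵢ}|`): let `K` be a set of graphs closed under subgraphs, `P ⊆ K` a set of patterns each
with at least one edge, `g 0, …, g (L-1)` monotone functions ⋆-closed w.r.t. `K` (bias
`0 < p ≤ 1/2`, threshold `0 < t ≤ 1/2`), and `M` a family of `k`-subsets of `[n]` (`k ≤ n`) such
that every `A ∈ M` is covered by a minterm `H ∈ P`, `H ⊆ K_A`, of some `g m`. Then
`|M| ≤ L · C(n,k) · Σ_{(v,s)} (B log(s/t)/p)^s (k/n)^v`, the sum over the signatures
`(supp H, |E_H|)` of the patterns `H ∈ P`. Proof as printed: group the pairs (gate, pattern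
minterm) by signature; a pattern on `v` vertices lies inside `K_A` for at most
`C(n,k) (k/n)^v` sets `A` (`card_filter_supset_mul_pow_le`), and by Lemma 9
(`card_minterms_le_of_isClosedFn`) each `g m` has at most `(B log(s/t)/p)^s` minterms in `K` with
`s ≥ 1` edges of a given signature. [cite: Rossman2010, Lemma 16 with Lemma 9 (pp. 7, 9)] -/
theorem card_covered_cliques_le_of_subset {n k : ℕ} (hkn : k ≤ n) (hn : 0 < n) {p t : ℝ}
    (hp0 : 0 < p) (hp1 : p ≤ 1 / 2) (ht0 : 0 < t) (ht1 : t ≤ 1 / 2) (L : ℕ)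
    {K P : Finset ((⊤ : SimpleGraph (Fin n)).edgeSet → Bool)}
    (hK : ∀ x ∈ K, ∀ y, y ≤ x → y ∈ K) (hPK : P ⊆ K) (hP1 : ∀ H ∈ P, 1 ≤ #(onSet H))
    (g : ℕ → ((⊤ : SimpleGraph (Fin n)).edgeSet → Bool) → Bool)
    (hg : ∀ m < L, Monotone (g m) ∧ IsClosedFn p t K (g m))
    (M : Finset (Finset (Fin n))) (hM : M ⊆ powersetCard k univ)
    (hcov : ∀ A ∈ M, ∃ m < L, ∃ H ∈ P, IsMinterm (g m) H ∧ H ≤ cliqueVec A) :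
    (#M : ℝ) ≤ L * (n.choose k * ∑ σ ∈ P.image sig, sigWeight n k p t σ) := by
  -- adapted from `card_covered_cliques_le` (RossmanMonotoneCliqueFinite.lean): the pairs
  set Pairs := ((range L) ×ˢ P).filter fun q => IsMinterm (g q.1) q.2 with hPairs
  -- Step 1: cover `M` by the fibres of the pairs
  have h1 : #M ≤ ∑ q ∈ Pairs,
      #((powersetCard k (univ : Finset (Fin n))).filter fun A => supp q.2 ⊆ A) := by
    calc #M ≤ #(Pairs.biUnion fun q =>
          (powersetCard k (univ : Finset (Fin n))).filter fun A => supp q.2 ⊆ A) := by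
          refine card_le_card fun A hA => ?_
          obtain ⟨m, hm, H, hH, hmin, hle⟩ := hcov A hA
          rw [mem_biUnion]
          refine ⟨(m, H), ?_, ?_⟩
          · rw [hPairs, mem_filter, mem_product, mem_range]; exact ⟨⟨hm, hH⟩, hmin⟩
          · rw [mem_filter]; exact ⟨hM hA, (le_cliqueVec_iff H A).1 hle⟩
      _ ≤ _ := card_biUnion_le
  -- Step 2: each fibre has at most `C(n,k) (k/n)^{supp H}` elements
  have h2 : ∀ H : (⊤ : SimpleGraph (Fin n)).edgeSet → Bool,
      (#((powersetCard k (univ : Finset (Fin n))).filter fun A => supp H ⊆ A) : ℝ) ≤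
        n.choose k * ((k : ℝ) / n) ^ #(supp H) := by
    intro H
    have := card_filter_supset_mul_pow_le hkn (supp H)
    have hnv : (0 : ℝ) < (n : ℝ) ^ #(supp H) := by positivity
    rw [div_pow, mul_div_assoc', le_div_iff₀ hnv]
    calc (#((powersetCard k (univ : Finset (Fin n))).filter fun A => supp H ⊆ A) : ℝ) *
          (n : ℝ) ^ #(supp H)
        ≤ (k : ℝ) ^ #(supp H) * n.choose k := by exact_mod_cast this
      _ = n.choose k * (k : ℝ) ^ #(supp H) := by ring
  -- Step 3: for each gate, group the pattern minterms by signature and apply Lemma 9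
  have h3 : ∀ m < L, ∑ H ∈ P.filter (fun H => IsMinterm (g m) H), ((k : ℝ) / n) ^ #(supp H)
      ≤ ∑ σ ∈ P.image sig, sigWeight n k p t σ := by
    intro m hm
    set Pm := P.filter (fun H => IsMinterm (g m) H) with hPm
    rw [← sum_fiberwise_of_maps_to (s := Pm) (t := P.image sig) (g := sig)
      (fun H hH => mem_image_of_mem sig (mem_of_mem_filter H hH))]
    refine sum_le_sum fun σ hσ => ?_
    obtain ⟨H₀, hH₀, rfl⟩ := mem_image.1 hσ
    have hs1 : 1 ≤ (sig H₀).2 := hP1 H₀ hH₀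
    calc ∑ H ∈ Pm.filter (fun H => sig H = sig H₀), ((k : ℝ) / n) ^ #(supp H)
        = ∑ H ∈ Pm.filter (fun H => sig H = sig H₀), ((k : ℝ) / n) ^ (sig H₀).1 := by
          refine sum_congr rfl fun H hH => ?_
          rw [(mem_filter.1 hH).2.symm]; rfl
      _ = #(Pm.filter fun H => sig H = sig H₀) * ((k : ℝ) / n) ^ (sig H₀).1 := by
          rw [sum_const, nsmul_eq_mul]
      _ ≤ (spreadConst * Real.log ((sig H₀).2 / t) / p) ^ (sig H₀).2 *
            ((k : ℝ) / n) ^ (sig H₀).1 := by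
          refine mul_le_mul_of_nonneg_right ?_ (by positivity)
          refine card_minterms_le_of_isClosedFn hp0 hp1 ht0 ht1 hK (hg m hm).1 (hg m hm).2 hs1 _
            fun H hH => ?_
          rw [mem_filter, hPm, mem_filter] at hH
          exact ⟨hPK hH.1.1, hH.1.2, (congrArg Prod.snd hH.2 : _)⟩
  -- assemble
  calc (#M : ℝ) ≤ ∑ q ∈ Pairs,
        (#((powersetCard k (univ : Finset (Fin n))).filter fun A => supp q.2 ⊆ A) : ℝ) := by
        exact_mod_cast h1
    _ ≤ ∑ q ∈ Pairs, n.choose k * ((k : ℝ) / n) ^ #(supp q.2) := sum_le_sum fun q _ => h2 q.2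
    _ = n.choose k * ∑ q ∈ Pairs, ((k : ℝ) / n) ^ #(supp q.2) := by rw [mul_sum]
    _ = n.choose k * ∑ m ∈ range L, ∑ H ∈ P.filter (fun H => IsMinterm (g m) H),
          ((k : ℝ) / n) ^ #(supp H) := by
        congr 1
        rw [hPairs, sum_filter, sum_product]
        refine sum_congr rfl fun m _ => ?_
        rw [sum_filter]
    _ ≤ n.choose k * ∑ m ∈ range L, ∑ σ ∈ P.image sig, sigWeight n k p t σ := by
        refine mul_le_mul_of_nonneg_left (sum_le_sum fun m hm => h3 m (mem_range.1 hm))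
          (Nat.cast_nonneg _)
    _ = L * (n.choose k * ∑ σ ∈ P.image sig, sigWeight n k p t σ) := by
        rw [sum_const, card_range, nsmul_eq_mul]; ring

/-- **Lemma 16 with Lemma 9 at a decoupled class parameter** (Rossman 2010, p. 9; the
two-parameter form of `card_covered_cliques_le`): with `I = smallI n k'`, `J = medJ n k'` for any
`k'`, if every `k`-set `A ∈ M` (`k ≤ n`) is covered by a minterm `H ∈ J`, `H ⊆ K_A`, of one of
`L` monotone functions ⋆-closed w.r.t. `I ∪ J`, then
`|M| ≤ L · C(n,k) · Σ_{(v,s) ∈ sig(J)} (B log(s/t)/p)^s (k/n)^v` (`k` the clique size).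
[cite: Rossman2010, Lemma 16 (p. 9)] -/
theorem card_covered_cliques_le₂ {n k k' : ℕ} (hkn : k ≤ n) (hn : 0 < n) {p t : ℝ} (hp0 : 0 < p)
    (hp1 : p ≤ 1 / 2) (ht0 : 0 < t) (ht1 : t ≤ 1 / 2) (L : ℕ)
    (g : ℕ → ((⊤ : SimpleGraph (Fin n)).edgeSet → Bool) → Bool)
    (hg : ∀ m < L, Monotone (g m) ∧ IsClosedFn p t (smallI n k' ∪ medJ n k') (g m))
    (M : Finset (Finset (Fin n))) (hM : M ⊆ powersetCard k univ)
    (hcov : ∀ A ∈ M, ∃ m < L, ∃ H ∈ medJ n k', IsMinterm (g m) H ∧ H ≤ cliqueVec A) :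
    (#M : ℝ) ≤ L * (n.choose k * ∑ σ ∈ (medJ n k').image sig, sigWeight n k p t σ) :=
  card_covered_cliques_le_of_subset hkn hn hp0 hp1 ht0 ht1 L (K := smallI n k' ∪ medJ n k')
    (P := medJ n k') (fun _ hx _ hyx => mem_smallI_union_medJ_of_le hx hyx) subset_union_right
    (fun _ hH => (medJ_ineq hH).1) g hg M hM hcov

/-- **The I-count replacing Lemma 15** (variant, not in the source: the computation of
Lemma 16 with Lemma 9 run over the non-empty SMALL patterns instead of `J`): for ONE monotone
function `f`, ⋆-closed w.r.t. `smallI n k' ∪ medJ n k'`, if every `k`-set `A ∈ M` (`k ≤ n`) is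
covered by a minterm `H ∈ I = smallI n k'` of `f` with `E_H ≠ ∅` and `H ⊆ K_A`, then
`|M| ≤ C(n,k) · Σ_{(v,s) ∈ sig{H ∈ I : |E_H| ≥ 1}} (B log(s/t)/p)^s (k/n)^v`.
[cite: Rossman2010, Lemma 9 and Lemma 16 (pp. 7, 9)] -/
theorem card_smallCovered_cliques_le {n k k' : ℕ} (hkn : k ≤ n) (hn : 0 < n) {p t : ℝ}
    (hp0 : 0 < p) (hp1 : p ≤ 1 / 2) (ht0 : 0 < t) (ht1 : t ≤ 1 / 2)
    (f : ((⊤ : SimpleGraph (Fin n)).edgeSet → Bool) → Bool)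
    (hf : Monotone f) (hc : IsClosedFn p t (smallI n k' ∪ medJ n k') f)
    (M : Finset (Finset (Fin n))) (hM : M ⊆ powersetCard k univ)
    (hcov : ∀ A ∈ M, ∃ H ∈ smallI n k', 1 ≤ #(onSet H) ∧ IsMinterm f H ∧ H ≤ cliqueVec A) :
    (#M : ℝ) ≤ n.choose k *
      ∑ σ ∈ ((smallI n k').filter fun H => 1 ≤ #(onSet H)).image sig, sigWeight n k p t σ := by
  have hcov' : ∀ A ∈ M, ∃ m < 1, ∃ H ∈ (smallI n k').filter (fun H => 1 ≤ #(onSet H)),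
      IsMinterm f H ∧ H ≤ cliqueVec A := fun A hA => by
    obtain ⟨H, hH, hH1, hmin, hle⟩ := hcov A hA
    exact ⟨0, Nat.one_pos, H, mem_filter.2 ⟨hH, hH1⟩, hmin, hle⟩
  have key := card_covered_cliques_le_of_subset hkn hn hp0 hp1 ht0 ht1 1
    (K := smallI n k' ∪ medJ n k') (P := (smallI n k').filter fun H => 1 ≤ #(onSet H))
    (fun _ hx _ hyx => mem_smallI_union_medJ_of_le hx hyx)
    ((filter_subset _ _).trans subset_union_left) (fun _ hH => (mem_filter.1 hH).2)
    (fun _ => f) (fun _ _ => ⟨hf, hc⟩) M hM hcov'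
  simpa only [Nat.cast_one, one_mul] using key

/-! ### The sparse-noise Theorem 1, finite form -/

/-- **Rossman 2010, Theorem 1, sparse-noise variant, finite form** (§6 with (i) the class
parameter `k'` of `I = smallI n k'`, `J = medJ n k'` decoupled from the clique size `k`,
`5 ≤ k' ≤ k ≤ n`, and (ii) Lemma 15 replaced by the I-count `card_smallCovered_cliques_le`;
variant — the I-count replacing Lemma 15 is not in the source). For `0 < p ≤ 1/2`,
`0 < t ≤ 1/2`, `t < 1 - p` and a circuit `C` over `{∧₂, ∨₂, 0, 1}` on the edges of `Kₙ`, EITHER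
`Pr_A[C(K_A) = 1] ≤ Σ_{σ ∈ sig{H ∈ I : E_H ≠ ∅}} W σ + size(C) · Σ_{σ ∈ sig(J)} W σ` with
`W (v,s) = sigWeight n k p t (v,s) = (B log(s/t)/p)^s (k/n)^v`, OR
`1 - size(C) · |I ∪ J| · t ≤ Pr[C(G(n,p)) = 1]`, the latter probability written as
`gnpProb n p {x | C x = 1}` (`= prob p (C · = 1)` by `gnpProb_filter_eq_prob`).
Proof: a constant circuit satisfies one of the two trivially; otherwise pass to a
`{∧₂, ∨₂}`-circuit `C'` of size `≤ size C` computing the same function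
(`const_or_exists_monotone_circuit`) and take its ⋆-closed approximation `C̄`
(`exists_closedApprox`; single edges lie in `I` as `k' ≥ 5`). If `C̄(∅) = 1` then `C̄ ≡ 1` and
Lemma 13 (`err`) gives the second alternative. If `C̄(∅) = 0`, every accepted `K_A` is accepted
by `C̄` (`dom`) hence lies above a NON-EMPTY minterm `H` of `C̄`; either `H ∈ I`, or by Lemma 14
(`loc`) some gate of `C̄` has a minterm in `J` below `K_A`; the two families of `k`-sets are
counted by `card_smallCovered_cliques_le` and `card_covered_cliques_le₂`.
[cite: Rossman2010, Thm 1 and Lemmas 9, 13, 14, 16 (pp. 4, 7–9)] -/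
theorem thm1_sparse_finite {n k k' : ℕ} (hk' : 5 ≤ k') (hk'k : k' ≤ k) (hkn : k ≤ n) {p t : ℝ}
    (hp0 : 0 < p) (hp1 : p ≤ 1 / 2) (ht0 : 0 < t) (ht1 : t ≤ 1 / 2) (htp : t < 1 - p)
    (C : Circuit ((⊤ : SimpleGraph (Fin n)).edgeSet)) (hC : C.IsOver monotoneBasis01) :
    kSubsetProb n k (fun A => C.eval (cliqueVec A) = true) ≤
        (∑ σ ∈ ((smallI n k').filter fun H => 1 ≤ #(onSet H)).image sig, sigWeight n k p t σ) +
          C.size * ∑ σ ∈ (medJ n k').image sig, sigWeight n k p t σ ∨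
      1 - C.size * (#(smallI n k' ∪ medJ n k') * t) ≤
        gnpProb n p (univ.filter fun x => C.eval x = true) := by
  rw [gnpProb_filter_eq_prob]
  have hn0 : 0 < n := by omega
  have hp1' : p ≤ 1 := by linarith
  have ht1' : t ≤ 1 := by linarith
  -- the two sums of weights are nonnegative
  have hSI0 : 0 ≤ ∑ σ ∈ ((smallI n k').filter fun H => 1 ≤ #(onSet H)).image sig,
      sigWeight n k p t σ := sum_nonneg fun σ hσ => by
    obtain ⟨H, hH, rfl⟩ := mem_image.1 hσ
    exact sigWeight_nonneg hp0.le ht0 ht1' (mem_filter.1 hH).2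
  have hSJ0 : 0 ≤ ∑ σ ∈ (medJ n k').image sig, sigWeight n k p t σ := sum_nonneg fun σ hσ => by
    obtain ⟨H, hH, rfl⟩ := mem_image.1 hσ
    exact sigWeight_nonneg hp0.le ht0 ht1' (medJ_ineq hH).1
  -- name the three large constants by plain variables (opaque to automation)
  obtain ⟨SI, hSI⟩ : ∃ S, ∑ σ ∈ ((smallI n k').filter fun H => 1 ≤ #(onSet H)).image sig,
      sigWeight n k p t σ = S := ⟨_, rfl⟩
  obtain ⟨SJ, hSJ⟩ : ∃ S, ∑ σ ∈ (medJ n k').image sig, sigWeight n k p t σ = S := ⟨_, rfl⟩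
  obtain ⟨NK, hNK⟩ : ∃ N : ℝ, (#(smallI n k' ∪ medJ n k') : ℝ) = N := ⟨_, rfl⟩
  rw [hSI] at hSI0 ⊢; rw [hSJ] at hSJ0 ⊢; rw [hNK]
  have hNK0 : 0 ≤ NK := by rw [← hNK]; exact Nat.cast_nonneg _
  have hCKt : 0 ≤ (C.size : ℝ) * (NK * t) :=
    mul_nonneg (Nat.cast_nonneg _) (mul_nonneg hNK0 ht0.le)
  -- reduce to `{∧₂, ∨₂}`-circuits
  rcases const_or_exists_monotone_circuit C.gates C.output (wf_gates C) hC C.wf_output with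
    ⟨b, hb⟩ | ⟨C', hC', hsize', hC'eval⟩
  · cases b
    · left
      have : kSubsetProb n k (fun A => C.eval (cliqueVec A) = true) = 0 := by
        unfold kSubsetProb
        rw [filter_false_of_mem, card_empty, Nat.cast_zero, zero_div]
        intro A _
        rw [circuit_eval, hb]; exact Bool.false_ne_true
      rw [this]
      exact add_nonneg hSI0 (mul_nonneg (Nat.cast_nonneg _) hSJ0)
    · right
      have : prob p (fun x => C.eval x = true) = 1 := by
        rw [← prob_true (ι := (⊤ : SimpleGraph (Fin n)).edgeSet) p]
        exact prob_congr fun x => by rw [circuit_eval, hb]; simp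
      rw [this]; linarith
  -- the main case: a `{∧₂, ∨₂}`-circuit `C'` computing `C`
  have heval : ∀ x, C'.eval x = C.eval x := fun x => by rw [hC'eval, circuit_eval]
  set L := C'.gates.length with hL
  have hLsize : (L : ℝ) ≤ C.size := by exact_mod_cast hsize'
  obtain ⟨ap, hap⟩ := exists_closedApprox hp0.le hp1' ht0.le htp
    (fun e => indVec_singleton_mem_smallI (n := n) hk' e)
    (fun x hx y hy => sup_mem_smallI_union_medJ hx hy) C'.gates (wf_gates C') hC'
  set fbar := ap C'.output with hfbar
  have hout : OutOK C'.gates.length C'.output := C'.wf_output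
  have hfm : Monotone fbar := hap.mono _ hout
  have hfc : IsClosedFn p t (smallI n k' ∪ medJ n k') fbar := hap.closed _ hout
  have hfdom : ∀ x, C.eval x = true → fbar x = true := fun x hx =>
    hap.dom _ hout x (by rw [← circuit_eval, heval]; exact hx)
  by_cases hbot : fbar ⊥ = true
  · -- `C̄ ≡ 1`: Lemma 13 alone bounds `Pr[C(G) = 0]`
    right
    have hall : prob p (fun x => fbar x = true) = 1 := by
      rw [← prob_true (ι := (⊤ : SimpleGraph (Fin n)).edgeSet) p]
      exact prob_congr fun x => by simp [eq_true_of_monotone_le hfm bot_le hbot]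
    have hsub : ∀ x, (fbar x = true ∧ ¬ C.eval x = true) →
        ∃ m < C'.gates.length, (vals C'.gates x).getD m false ≠ ap (.inr m) x := by
      rintro x ⟨h1, h2⟩
      by_contra hbad
      have := hap.agree hbad _ hout
      rw [← circuit_eval, heval] at this
      exact h2 (this.trans h1)
    have hferr : prob p (fun x => fbar x = true ∧ ¬ C.eval x = true) ≤ L * (NK * t) := by
      rw [← hNK]
      exact (prob_mono hp0.le hp1' hsub).trans hap.err
    have hsplit := prob_le_prob_add_prob_and_not hp0.le hp1' (fun x => fbar x = true)
      (fun x => C.eval x = true)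
    have hLK : (L : ℝ) * (NK * t) ≤ C.size * (NK * t) :=
      mul_le_mul_of_nonneg_right hLsize (mul_nonneg hNK0 ht0.le)
    linarith
  · -- `C̄(∅) = 0`: every accepted clique lies above a non-empty small minterm of `C̄`, or
    -- (Lemma 14) above a medium minterm of a gate of `C̄`
    left
    have hcover : ∀ A, C.eval (cliqueVec A) = true →
        (∃ H ∈ smallI n k', 1 ≤ #(onSet H) ∧ IsMinterm fbar H ∧ H ≤ cliqueVec A) ∨
          ∃ m < L, ∃ H ∈ medJ n k', IsMinterm (ap (.inr m)) H ∧ H ≤ cliqueVec A := by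
      intro A hA
      obtain ⟨H, hHle, hHmin⟩ := exists_minterm_le (hfdom _ hA)
      have hH1 : 1 ≤ #(onSet H) := by
        rw [Nat.one_le_iff_ne_zero, Ne, card_eq_zero]
        intro h0
        have hH : H = ⊥ :=
          onSet_injective (by rw [h0, onSet_bot] : onSet H = onSet (⊥ : _ → Bool))
        rw [hH] at hHmin
        exact hbot hHmin.1
      rw [or_iff_not_imp_right]
      intro hno
      push Not at hno
      exact ⟨H, hap.loc (cliqueVec A) (fun m hm H' hH' hle' hJ => hno m hm H' hJ hH' hle') _ hout
        H hHmin hHle, hH1, hHmin, hHle⟩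
    -- the two covered families of `k`-sets
    set MI := (powersetCard k (univ : Finset (Fin n))).filter fun A =>
      ∃ H ∈ smallI n k', 1 ≤ #(onSet H) ∧ IsMinterm fbar H ∧ H ≤ cliqueVec A with hMI
    set MJ := (powersetCard k (univ : Finset (Fin n))).filter fun A =>
      ∃ m < L, ∃ H ∈ medJ n k', IsMinterm (ap (.inr m)) H ∧ H ≤ cliqueVec A with hMJ
    have hIcount : (#MI : ℝ) ≤ n.choose k * SI := by
      rw [← hSI]
      exact card_smallCovered_cliques_le hkn hn0 hp0 hp1 ht0 ht1 fbar hfm hfc MI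
        (filter_subset _ _) fun A hA => (mem_filter.1 hA).2
    have hg : ∀ m < L, Monotone (ap (.inr m)) ∧
        IsClosedFn p t (smallI n k' ∪ medJ n k') (ap (.inr m)) := by
      intro m hm
      have hw : OutOK C'.gates.length (.inr m : (⊤ : SimpleGraph (Fin n)).edgeSet ⊕ ℕ) := by
        intro m' h; cases h; exact hm
      exact ⟨hap.mono _ hw, hap.closed _ hw⟩
    have hJcount : (#MJ : ℝ) ≤ L * (n.choose k * SJ) := by
      rw [← hSJ]
      exact card_covered_cliques_le₂ hkn hn0 hp0 hp1 ht0 ht1 L (fun m => ap (.inr m)) hg MJ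
        (filter_subset _ _) fun A hA => (mem_filter.1 hA).2
    have hsub : (powersetCard k (univ : Finset (Fin n))).filter
        (fun A => C.eval (cliqueVec A) = true) ⊆ MI ∪ MJ := by
      intro A hA
      rw [mem_filter] at hA
      rw [mem_union, hMI, hMJ, mem_filter, mem_filter]
      rcases hcover A hA.2 with h | h
      · exact Or.inl ⟨hA.1, h⟩
      · exact Or.inr ⟨hA.1, h⟩
    have hcard : (#((powersetCard k (univ : Finset (Fin n))).filter
        fun A => C.eval (cliqueVec A) = true) : ℝ) ≤ #MI + #MJ := by
      exact_mod_cast (card_le_card hsub).trans (card_union_le _ _)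
    have hchoose : (0 : ℝ) < n.choose k := by exact_mod_cast Nat.choose_pos hkn
    have hLJ : (L : ℝ) * (n.choose k * SJ) ≤ C.size * (n.choose k * SJ) :=
      mul_le_mul_of_nonneg_right hLsize (mul_nonneg (Nat.cast_nonneg _) hSJ0)
    unfold kSubsetProb
    rw [div_le_iff₀ hchoose]
    calc (#((powersetCard k (univ : Finset (Fin n))).filter
            fun A => C.eval (cliqueVec A) = true) : ℝ)
        ≤ #MI + #MJ := hcard
      _ ≤ n.choose k * SI + C.size * (n.choose k * SJ) := add_le_add hIcount (hJcount.trans hLJ)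
      _ = (SI + C.size * SJ) * n.choose k := by ring

end Literature.Computability.Complexity
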